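/-
Copyright (c) 2026 the pub-hodgecm-mathlib formalisation cell (harness21).  Prover seat hodgecm-mathlib-F0P3-p01 (g30), «(D-RAM) FOUR-FRAME» road of crux H413
(dealer LH4-plan (g10) WORD #31 deal #10b «(ii-G) ANCHOR DICTIONARY, t = 2», B-p04 (g61) backlog): the census dictionary Prop `AnchorCountDictionary 2` IS PAID.  2026-09-03.
-/
import Summits.HodgeConjecture.HodgeConjecture.Theorems.F0P3cDyRamAnchorCountDictionaryZero   -- ★ #10 p854635 (LH4-p01): the `t = 0` twin; `exists_eigenframe_localRing_of_coe_eq_smul_frameElt` (t-free §1) and every ★ it brings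
import Summits.HodgeConjecture.HodgeConjecture.Theorems.F0P3cDyRamWildPlaceDatum              -- ★ #12 p854601 (LH4-p02): `exists_isRamifiedQuadraticDatum_of_placesOver` (the datum at a ramified CM place)
import Literature.NumberTheory.Automorphic.UnitaryLatticeTreeEulerRelationWild                 -- ★ p854681 (LH4-p01): brings htr₂-WILD `forall_isVertexLattice_two_exists_mapGL_N₁_eq_of_ramified`, `v_map_sub_self_lt_one_of_even`
import Literature.NumberTheory.Automorphic.UnitaryLatticeTreeLevelIndices                      -- ★ `isCompact_conj_glInt_subgroupOf`, `isOpen_conj_glInt_subgroupOf` (`U ∩ g GL₃(𝒪) g⁻¹` is compact open)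
import Literature.NumberTheory.Automorphic.UnitaryLatticeTreeFixedCosetStrataDictionary         -- ★ `mapGL_stdLattice_eq_iff_mem_glInt`
import Literature.NumberTheory.Automorphic.AdicCompletionCompact                               -- ★ `compactSpace_integer_adicCompletion`, `finite_residueField_adicCompletion`
import Literature.NumberTheory.Rogawski1990.RankOneKappaVertexCoverCM                         -- ★ `Literature.GroupTheory.isCompact_coe_comap_continuousMulEquiv`, `isOpen_coe_comap_of_continuous`
import HarnessLib

/-!
# F0 · P3c · line LH4 «(D-RAM) FOUR-FRAME» — unit (ii-G): THE CENSUS DICTIONARY AT THE TYPE-`2` ANCHOR, `anchorCountDictionary_two : AnchorCountDictionary 2`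
# (Kottwitz 1986 §3; Rogawski 1990 §4.9 Prop. 4.9.1 (b); Laumon 1996 Lemma (5.3.2))

Cell `pub/hodgecm-mathlib`, crux H413 = `stmt-HodgeConjecture-24833` (helper lane `--supports stmt-HodgeConjecture-24833 --as helper`), route HCCMUnconditional; THEOREMS ONLY
(no definition, no instance, no notation, no named fact, no `sorry`, no `set_option` beyond `autoImplicit false`; default heartbeats).  Conclusion = the dealer's №2b Prop
`Summit.….Cruxes.H413.F0P3cDyRamFourFrameDictionaryDefs.AnchorCountDictionary 2` BY NAME — the `t = 2` twin of ★ #10 `anchorCountDictionary_zero` (LH4-p01 (g17)), consumed by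
★ #11 `anchorRows_of_fourFrameLaws (hDG : AnchorCountDictionary tv)` at the vertex type `tv = 2`.

THE MATHEMATICS.  At a ramified non-split place `w ∣ v` of the CM field `L`, `G = U(Φ₃)(L⁺_v)` with its one-place model `e : G ≃ₜ* U(σ_w, Φ₃)(L_w)`, `N` a TYPE-2 vertex of
`(L_w³, J₀)` and `K₂ = Stab_G(N)`; `γ ∈ G` with `e(γ) = z·Γ`, `Γ = frameElt σ_w f b α β`, `α, β, z ∈ L_w¹`, `α ≠ β`, `α, β ≠ 1`.  Everything but the compact-open-ness of `K₂`
and the transitivity on type-2 vertices is the `t = 0` proof VERBATIM (★ #10 §1: the `E_v`-eigenframe of `γ` ⇒ regular with compact centraliser; ★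
`classOrbitalIntegral_indicator_complex_local_eq_natCard_fixedBy_mul`; ★ B-p04 `natCard_fixedBy_quotient_eq_fixedVertexCount_of_coe_eq_smul` at `t = 2`).  The two new inputs:
(2′) htr₂-WILD (★ `forall_isVertexLattice_two_exists_mapGL_N₁_eq_of_ramified`, at the datum of the place ★ `exists_isRamifiedQuadraticDatum_of_placesOver`): every type-2 vertex is
`u·N₁`, `N₁ = g₁·𝒪_w³`, `g₁ = diag(1, 1, ϖ)`, `u` unitary — so `U(σ_w, Φ₃)` is TRANSITIVE on type-2 vertices (§1 `exists_unitary_mapGL_eq_of_isVertexLattice_two_ramifiedCM`), and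
`K₂ = e⁻¹(U ∩ (u₀g₁)·GL₃(𝒪_w)·(u₀g₁)⁻¹)` is COMPACT OPEN (★ `isCompact_conj_glInt_subgroupOf` ∕ `isOpen_conj_glInt_subgroupOf`, `𝒪_w` compact, transported along the one-place
`ContinuousMulEquiv`, §1 `isCompact_and_isOpen_of_forall_mem_iff_mapGL_eq_two`).  The constant is `C := νG₃(K₂)`.

* §1 (CM place) `exists_unitary_mapGL_eq_of_isVertexLattice_two_ramifiedCM`, `isCompact_and_isOpen_of_forall_mem_iff_mapGL_eq_two`.
* §2 `classOrbitalIntegral_indicator_eq_mul_fixedVertexCount_two` (all binders explicit) and the head **`anchorCountDictionary_two : AnchorCountDictionary 2`**.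

HONEST LABEL: HC_CM is proved only modulo the 7 printed citations (2 remaining named inputs: hLiu418 = stmt-HodgeConjecture-24832, h413 = stmt-HodgeConjecture-24833) until
rung 0 closes; this file pays the LAYER-2 Prop (D-G) at `t = 2` of the sibling line (count-neutral until the line closes its organ).

## References
* [Kottwitz1986BaseChangeUnits] R. E. Kottwitz, *Base change for unit elements of Hecke algebras*, Compositio Math. 60 (1986) 237–250, §1 pp. 240–241.
* [Rogawski1990] J. D. Rogawski, *Automorphic Representations of Unitary Groups in Three Variables*, Ann. of Math. Stud. 123 (1990), §4.9 p. 54, Prop. 4.9.1 (b) p. 55, §3.6 pp. 31–32.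
* [Laumon1995] G. Laumon, *Cohomology of Drinfeld Modular Varieties* I (1996), Lemma (5.3.2) p. 136.
* [BruhatTits1972] F. Bruhat, J. Tits, *Groupes réductifs sur un corps local I*, Publ. Math. IHÉS 41 (1972), §10 (vertex stabilisers are compact open).
-/

set_option autoImplicit false

noncomputable section

open scoped Valued WithZero Matrix MatrixGroups
open MeasureTheory Measure NumberField IsDedekindDomain Matrix
open Literature.NumberTheory.Automorphic Literature.NumberTheory.Automorphic.UnitaryGroup Literature.NumberTheory.Automorphic.HermitianLattice
open Literature.NumberTheory.Automorphic.UnitaryLatticeTree Literature.NumberTheory.Automorphic.UnitaryThreeFourFrame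
open Literature.NumberTheory.Rogawski1990
open Summit.HodgeConjecture.HodgeConjecture.Cruxes.H413.F0P3cDyRamAnchorCountDictionaryZero
open Summit.HodgeConjecture.HodgeConjecture.Cruxes.H413.F0P3cDyRamWildPlaceDatum

namespace Summit.HodgeConjecture.HodgeConjecture.Cruxes.H413.F0P3cDyRamAnchorCountDictionaryTwo

/-! ## §1 At the CM place: transitivity on type-2 vertices; the stabiliser of a type-2 vertex is compact open -/

section CM

variable (L : Type) [Field L] [NumberField L] [IsCMField L] {v : HeightOneSpectrum (𝓞 ↥(maximalRealSubfield L))}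
  (w : PlacesOver L v) (hw : IsCMField.complexConj L • w.1 = w.1)

include hw in
/-- **htr₂ AT A RAMIFIED CM PLACE, WILD INCLUDED**: every type-2 vertex of `(L_w³, J₀)` is `u·(g₁·𝒪_w³)`, `g₁ = diag(1, 1, ϖ)`, for a unitary `u` (★ htr₂-WILD
`forall_isVertexLattice_two_exists_mapGL_N₁_eq_of_ramified` at the datum of the place, ★ `exists_isRamifiedQuadraticDatum_of_placesOver`); hence any two type-2 vertices
`N, M` are related by a unitary: `u·N = M`. [cite: BruhatTits1972, §10] [cite: Rogawski1990, §4.9 p. 54] -/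
theorem exists_unitary_mapGL_eq_of_isVertexLattice_two_ramifiedCM (he : v.asIdeal.ramificationIdx' w.1.asIdeal ≠ 1)
    {ϖ : w.1.adicCompletion L} (hϖ : Valued.v ϖ = WithZero.exp (-1 : ℤ))
    {N M : Submodule 𝒪[w.1.adicCompletion L] (Fin 3 → w.1.adicCompletion L)}
    (hN : IsVertexLattice (galAdicCompletionMap (L := L) (IsCMField.complexConj L) hw) ϖ ((StdForm.antidiagonal 3).over (w.1.adicCompletion L)) 2 N)
    (hM : IsVertexLattice (galAdicCompletionMap (L := L) (IsCMField.complexConj L) hw) ϖ ((StdForm.antidiagonal 3).over (w.1.adicCompletion L)) 2 M) :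
    ∃ u : ↥(unitaryGroupOfForm (galAdicCompletionMap (L := L) (IsCMField.complexConj L) hw) ((StdForm.antidiagonal 3).over (w.1.adicCompletion L))),
      mapGL (u : GL (Fin 3) (w.1.adicCompletion L)) N = M := by
  haveI : Finite 𝓀[w.1.adicCompletion L] := finite_residueField_adicCompletion L w.1
  obtain ⟨d, t, hD⟩ := exists_isRamifiedQuadraticDatum_of_placesOver L w hw he ϖ hϖ
  obtain ⟨hσσ, hvσ, -, heven, hdv, h1d, h2t⟩ := hD
  have hϖ0 : ϖ ≠ 0 := (Valuation.ne_zero_iff _).1 (by rw [hϖ]; exact WithZero.exp_ne_zero)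
  have h20 : (2 : w.1.adicCompletion L) ≠ 0 := fun h => by
    rw [h, map_zero] at h2t
    exact pow_ne_zero t ((Valuation.ne_zero_iff Valued.v).2 hϖ0) h2t.symm
  have hres : ∀ x : w.1.adicCompletion L, Valued.v x ≤ 1 →
      Valued.v (galAdicCompletionMap (L := L) (IsCMField.complexConj L) hw x - x) < 1 := fun x hx => v_map_sub_self_lt_one_of_even hσσ hϖ heven hdv h1d hx
  obtain ⟨uN, huN⟩ := forall_isVertexLattice_two_exists_mapGL_N₁_eq_of_ramified hσσ hvσ hϖ hres heven h20 N hN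
  obtain ⟨uM, huM⟩ := forall_isVertexLattice_two_exists_mapGL_N₁_eq_of_ramified hσσ hvσ hϖ hres heven h20 M hM
  refine ⟨uM * uN⁻¹, ?_⟩
  rw [huN, huM, Subgroup.coe_mul, Subgroup.coe_inv, mapGL_mul, mapGL_inv_mapGL]

include hw in
/-- **THE STABILISER OF A TYPE-2 VERTEX IS COMPACT OPEN** at a ramified non-split place: `K₂ = {y | e(y)·N = N}` with `N = u₀·g₁·𝒪_w³` (htr₂-WILD) is the pull-back along the
one-place `ContinuousMulEquiv` `e` of `U(σ_w, Φ₃) ∩ (u₀g₁)·GL₃(𝒪_w)·(u₀g₁)⁻¹`, compact open because `𝒪_w` is compact (★ `isCompact_conj_glInt_subgroupOf`,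
★ `isOpen_conj_glInt_subgroupOf`). [cite: BruhatTits1972, §10] [cite: Rogawski1990, §4.9 p. 54] -/
theorem isCompact_and_isOpen_of_forall_mem_iff_mapGL_eq_two (he : v.asIdeal.ramificationIdx' w.1.asIdeal ≠ 1)
    {ϖ : w.1.adicCompletion L} (hϖ : Valued.v ϖ = WithZero.exp (-1 : ℤ))
    {N : Submodule 𝒪[w.1.adicCompletion L] (Fin 3 → w.1.adicCompletion L)}
    (hN : IsVertexLattice (galAdicCompletionMap (L := L) (IsCMField.complexConj L) hw) ϖ ((StdForm.antidiagonal 3).over (w.1.adicCompletion L)) 2 N)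
    (Kt : Subgroup ((cmDatum L 3 (Matrix.of fun i j : Fin 3 => if i.val + j.val + 1 = 3 then (1 : L) else 0)).Local v))
    (hKt : ∀ u : ((cmDatum L 3 (Matrix.of fun i j : Fin 3 => if i.val + j.val + 1 = 3 then (1 : L) else 0)).Local v), u ∈ Kt ↔
      mapGL ((localNonsplitEquiv (IsCMField.complexConj L) (Matrix.of fun i j : Fin 3 => if i.val + j.val + 1 = 3 then (1 : L) else 0) (IsCMField.complexConj_ne_one L) w hw u :
        ↥(unitaryGroupOfForm (galAdicCompletionMap (L := L) (IsCMField.complexConj L) hw) (placeForm (Matrix.of fun i j : Fin 3 => if i.val + j.val + 1 = 3 then (1 : L) else 0) w.1))) :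
        GL (Fin 3) (w.1.adicCompletion L)) N = N) :
    IsCompact (Kt : Set ((cmDatum L 3 (Matrix.of fun i j : Fin 3 => if i.val + j.val + 1 = 3 then (1 : L) else 0)).Local v)) ∧
      IsOpen (Kt : Set ((cmDatum L 3 (Matrix.of fun i j : Fin 3 => if i.val + j.val + 1 = 3 then (1 : L) else 0)).Local v)) := by
  haveI : Finite 𝓀[w.1.adicCompletion L] := finite_residueField_adicCompletion L w.1
  haveI : CompactSpace 𝒪[w.1.adicCompletion L] := compactSpace_integer_adicCompletion L w.1
  obtain ⟨e, hecoe⟩ := exists_continuousMulEquiv_coe_eq_localNonsplitEquiv L (Matrix.of fun i j : Fin 3 => if i.val + j.val + 1 = 3 then (1 : L) else 0) v w hw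
  have hpf := placeForm_antidiagThree_eq_over L w
  -- the datum of the place and htr₂-WILD: `N = u₀·g₁·𝒪³`
  obtain ⟨d, t, hD⟩ := exists_isRamifiedQuadraticDatum_of_placesOver L w hw he ϖ hϖ
  obtain ⟨hσσ, hvσ, -, heven, hdv, h1d, h2t⟩ := hD
  have hϖ0 : ϖ ≠ 0 := (Valuation.ne_zero_iff _).1 (by rw [hϖ]; exact WithZero.exp_ne_zero)
  have h20 : (2 : w.1.adicCompletion L) ≠ 0 := fun h => by
    rw [h, map_zero] at h2t
    exact pow_ne_zero t ((Valuation.ne_zero_iff Valued.v).2 hϖ0) h2t.symm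
  have hres : ∀ x : w.1.adicCompletion L, Valued.v x ≤ 1 →
      Valued.v (galAdicCompletionMap (L := L) (IsCMField.complexConj L) hw x - x) < 1 := fun x hx => v_map_sub_self_lt_one_of_even hσσ hϖ heven hdv h1d hx
  obtain ⟨u₀, hu₀⟩ := forall_isVertexLattice_two_exists_mapGL_N₁_eq_of_ramified hσσ hvσ hϖ hres heven h20 N hN
  have hg₁det : (Matrix.diagonal ![(1 : w.1.adicCompletion L), 1, ϖ]).det ≠ 0 := by
    rw [Matrix.det_diagonal, Fin.prod_univ_three]
    simp only [Matrix.cons_val_zero, Matrix.cons_val_one, Matrix.cons_val_two, Matrix.head_cons, Matrix.tail_cons, one_mul]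
    exact hϖ0
  set g₁ : GL (Fin 3) (w.1.adicCompletion L) := Matrix.GeneralLinearGroup.mkOfDetNeZero _ hg₁det with hg₁_def
  have hg₁L : mapGL g₁ (stdLattice (w.1.adicCompletion L) 3) = latt (Matrix.diagonal ![(1 : w.1.adicCompletion L), 1, ϖ]) := rfl
  set P : GL (Fin 3) (w.1.adicCompletion L) := (u₀ : GL (Fin 3) (w.1.adicCompletion L)) * g₁ with hP_def
  have hNP : N = mapGL P (stdLattice (w.1.adicCompletion L) 3) := by rw [hP_def, mapGL_mul, hg₁L]; exact hu₀
  -- the compact open subgroup `U ∩ P·GL₃(𝒪)·P⁻¹` of the one-place model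
  set K' : Subgroup ↥(unitaryGroupOfForm (galAdicCompletionMap (L := L) (IsCMField.complexConj L) hw)
      (placeForm (Matrix.of fun i j : Fin 3 => if i.val + j.val + 1 = 3 then (1 : L) else 0) w.1)) :=
    ((glInt 3 (w.1.adicCompletion L)).map (MulAut.conj P).toMonoidHom).subgroupOf
      (unitaryGroupOfForm (galAdicCompletionMap (L := L) (IsCMField.complexConj L) hw) (placeForm (Matrix.of fun i j : Fin 3 => if i.val + j.val + 1 = 3 then (1 : L) else 0) w.1))
    with hK'_def
  have hK'c : IsCompact (K' : Set ↥(unitaryGroupOfForm (galAdicCompletionMap (L := L) (IsCMField.complexConj L) hw) (placeForm (Matrix.of fun i j : Fin 3 => if i.val + j.val + 1 = 3 then (1 : L) else 0) w.1))) :=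
    isCompact_conj_glInt_subgroupOf (galAdicCompletionMap (L := L) (IsCMField.complexConj L) hw) _ P (continuous_galAdicCompletionMap L (IsCMField.complexConj L) hw)
  have hK'o : IsOpen (K' : Set ↥(unitaryGroupOfForm (galAdicCompletionMap (L := L) (IsCMField.complexConj L) hw) (placeForm (Matrix.of fun i j : Fin 3 => if i.val + j.val + 1 = 3 then (1 : L) else 0) w.1))) :=
    isOpen_conj_glInt_subgroupOf (galAdicCompletionMap (L := L) (IsCMField.complexConj L) hw) _ P
  -- `Kt = e⁻¹ K'`
  have hmem : ∀ y, y ∈ Kt ↔ y ∈ K'.comap e.toMonoidHom := by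
    intro y
    rw [hKt y, Subgroup.mem_comap, hK'_def, Subgroup.mem_subgroupOf, Subgroup.mem_map_equiv, MulAut.conj_symm_apply,
      ← mapGL_stdLattice_eq_iff_mem_glInt, mapGL_mul, mapGL_mul, hNP]
    change mapGL _ (mapGL P _) = mapGL P _ ↔ mapGL P⁻¹ (mapGL ((e y : ↥(unitaryGroupOfForm (galAdicCompletionMap (L := L) (IsCMField.complexConj L) hw)
      (placeForm (Matrix.of fun i j : Fin 3 => if i.val + j.val + 1 = 3 then (1 : L) else 0) w.1))) : GL (Fin 3) (w.1.adicCompletion L)) (mapGL P _)) = _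
    rw [hecoe y]
    constructor
    · intro h; rw [h, mapGL_inv_mapGL]
    · intro h
      have h' := congrArg (mapGL P) h
      rw [← mapGL_mul, mul_inv_cancel, mapGL_one] at h'
      exact h'
  have hKeq : Kt = K'.comap e.toMonoidHom := Subgroup.ext hmem
  rw [hKeq]
  exact ⟨Literature.GroupTheory.isCompact_coe_comap_continuousMulEquiv e K' hK'c,
    Literature.GroupTheory.isOpen_coe_comap_of_continuous e.toMonoidHom e.continuous K' hK'o⟩

end CM

/-! ## §2 The head: `AnchorCountDictionary 2` -/

section Head

variable (L : Type) [Field L] [NumberField L] [IsCMField L] {v : HeightOneSpectrum (𝓞 ↥(maximalRealSubfield L))}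
  (w : PlacesOver L v) (hw : IsCMField.complexConj L • w.1 = w.1)

include hw in
/-- **THE DICTIONARY AT ONE PLACE, ALL BINDERS EXPLICIT**: for the canonical family `mG₃`, a TYPE-2 vertex `N` with stabiliser `K₂` (membership statement `hKt`), a four-frame
family `f`, `α, β, z ∈ L_w¹` with `α ≠ β`, `α, β ≠ 1`, `Γ = frameElt σ_w f b α β` and `γ` with one-place matrix `z·Γ`:
`Φ(⟦γ⟧, 1_{K₂}; mG₃) = νG₃(K₂) · fixedVertexCount σ_w ϖ 2 Γ`. [cite: Kottwitz1986BaseChangeUnits, §1 pp. 240–241] [cite: Rogawski1990, §4.9 Prop. 4.9.1 (b) p. 55] [cite: Laumon1995, Lemma (5.3.2) p. 136] -/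
theorem classOrbitalIntegral_indicator_eq_mul_fixedVertexCount_two (he : v.asIdeal.ramificationIdx' w.1.asIdeal ≠ 1)
    {ϖ : w.1.adicCompletion L} (hϖ : Valued.v ϖ = WithZero.exp (-1 : ℤ))
    [MeasurableSpace ((cmDatum L 3 (Matrix.of fun i j : Fin 3 => if i.val + j.val + 1 = 3 then (1 : L) else 0)).Local v)]
    [BorelSpace ((cmDatum L 3 (Matrix.of fun i j : Fin 3 => if i.val + j.val + 1 = 3 then (1 : L) else 0)).Local v)]
    [∀ γ : ((cmDatum L 3 (Matrix.of fun i j : Fin 3 => if i.val + j.val + 1 = 3 then (1 : L) else 0)).Local v),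
      MeasurableSpace (((cmDatum L 3 (Matrix.of fun i j : Fin 3 => if i.val + j.val + 1 = 3 then (1 : L) else 0)).Local v) ⧸
        Subgroup.centralizer ({γ} : Set ((cmDatum L 3 (Matrix.of fun i j : Fin 3 => if i.val + j.val + 1 = 3 then (1 : L) else 0)).Local v)))]
    [∀ γ : ((cmDatum L 3 (Matrix.of fun i j : Fin 3 => if i.val + j.val + 1 = 3 then (1 : L) else 0)).Local v),
      BorelSpace (((cmDatum L 3 (Matrix.of fun i j : Fin 3 => if i.val + j.val + 1 = 3 then (1 : L) else 0)).Local v) ⧸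
        Subgroup.centralizer ({γ} : Set ((cmDatum L 3 (Matrix.of fun i j : Fin 3 => if i.val + j.val + 1 = 3 then (1 : L) else 0)).Local v)))]
    (νG₃ : Measure ((cmDatum L 3 (Matrix.of fun i j : Fin 3 => if i.val + j.val + 1 = 3 then (1 : L) else 0)).Local v)) [νG₃.IsHaarMeasure] [νG₃.IsMulRightInvariant]
    {mG₃ : OrbitalMeasureFamily ((cmDatum L 3 (Matrix.of fun i j : Fin 3 => if i.val + j.val + 1 = 3 then (1 : L) else 0)).Local v)}
    (hcan : mG₃.IsCanonical (fun γ => IsRegularElt (γ.val : GL (Fin 3) (LocalRing L v))) νG₃)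
    {N : Submodule 𝒪[w.1.adicCompletion L] (Fin 3 → w.1.adicCompletion L)}
    (hN : IsVertexLattice (galAdicCompletionMap (L := L) (IsCMField.complexConj L) hw) ϖ ((StdForm.antidiagonal 3).over (w.1.adicCompletion L)) 2 N)
    (Kt : Subgroup ((cmDatum L 3 (Matrix.of fun i j : Fin 3 => if i.val + j.val + 1 = 3 then (1 : L) else 0)).Local v))
    (hKt : ∀ u : ((cmDatum L 3 (Matrix.of fun i j : Fin 3 => if i.val + j.val + 1 = 3 then (1 : L) else 0)).Local v), u ∈ Kt ↔
      mapGL ((localNonsplitEquiv (IsCMField.complexConj L) (Matrix.of fun i j : Fin 3 => if i.val + j.val + 1 = 3 then (1 : L) else 0) (IsCMField.complexConj_ne_one L) w hw u :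
        ↥(unitaryGroupOfForm (galAdicCompletionMap (L := L) (IsCMField.complexConj L) hw) (placeForm (Matrix.of fun i j : Fin 3 => if i.val + j.val + 1 = 3 then (1 : L) else 0) w.1))) :
        GL (Fin 3) (w.1.adicCompletion L)) N = N)
    {f : Fin 4 → Fin 3 → (Fin 3 → (w.1.adicCompletion L))} (hf : IsFourFrameFamily (galAdicCompletionMap (L := L) (IsCMField.complexConj L) hw) f)
    {α β z : w.1.adicCompletion L} (hα : α * (galAdicCompletionMap (L := L) (IsCMField.complexConj L) hw) α = 1)
    (hβ : β * (galAdicCompletionMap (L := L) (IsCMField.complexConj L) hw) β = 1) (hz : z * (galAdicCompletionMap (L := L) (IsCMField.complexConj L) hw) z = 1)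
    (hαβ : α ≠ β) (hα1 : α ≠ 1) (hβ1 : β ≠ 1) (b : Fin 4) {Γ : GL (Fin 3) (w.1.adicCompletion L)}
    (hΓ : (Γ : Matrix (Fin 3) (Fin 3) (w.1.adicCompletion L)) = frameElt (galAdicCompletionMap (L := L) (IsCMField.complexConj L) hw) f b α β)
    (γ : (cmDatum L 3 (Matrix.of fun i j : Fin 3 => if i.val + j.val + 1 = 3 then (1 : L) else 0)).Local v)
    (hγ : ((((localNonsplitEquiv (IsCMField.complexConj L) (Matrix.of fun i j : Fin 3 => if i.val + j.val + 1 = 3 then (1 : L) else 0) (IsCMField.complexConj_ne_one L) w hw γ :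
        ↥(unitaryGroupOfForm (galAdicCompletionMap (L := L) (IsCMField.complexConj L) hw) (placeForm (Matrix.of fun i j : Fin 3 => if i.val + j.val + 1 = 3 then (1 : L) else 0) w.1))) :
        GL (Fin 3) (w.1.adicCompletion L)) : Matrix (Fin 3) (Fin 3) (w.1.adicCompletion L))) = z • (Γ : Matrix (Fin 3) (Fin 3) (w.1.adicCompletion L))) :
    classOrbitalIntegral mG₃ (Set.indicator (Kt : Set ((cmDatum L 3 (Matrix.of fun i j : Fin 3 => if i.val + j.val + 1 = 3 then (1 : L) else 0)).Local v)) (fun _ => (1 : ℂ)))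
        (ConjClasses.mk γ) =
      ((νG₃ Kt).toReal : ℂ) * (fixedVertexCount (galAdicCompletionMap (L := L) (IsCMField.complexConj L) hw) ϖ 2 Γ : ℂ) := by
  have hc1 : IsCMField.complexConj L ≠ 1 := IsCMField.complexConj_ne_one L
  have hpf : placeForm (Matrix.of fun i j : Fin 3 => if i.val + j.val + 1 = 3 then (1 : L) else 0) w.1 = (StdForm.antidiagonal 3).over (w.1.adicCompletion L) :=
    placeForm_antidiagThree_eq_over L w
  have hH : ((Matrix.of fun i j : Fin 3 => if i.val + j.val + 1 = 3 then (1 : L) else 0).map (cmConjRingHom L))ᵀ =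
      Matrix.of fun i j : Fin 3 => if i.val + j.val + 1 = 3 then (1 : L) else 0 := antidiagOne_isHermitian L 3
  have hdet : (Matrix.of fun i j : Fin 3 => if i.val + j.val + 1 = 3 then (1 : L) else 0).det ≠ 0 := (isUnit_antidiagOne_det L 3).ne_zero
  have hvσ : ∀ a : w.1.adicCompletion L, Valued.v (galAdicCompletionMap (L := L) (IsCMField.complexConj L) hw a) = Valued.v a :=
    fun a => valued_galAdicCompletionMap (L := L) (IsCMField.complexConj L) hw a
  -- `K₂` is compact open
  obtain ⟨hKc, hKo⟩ := isCompact_and_isOpen_of_forall_mem_iff_mapGL_eq_two L w hw he hϖ hN Kt hKt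
  -- the dictionary's homomorphism `ι = e` into `GL₃(L_w)`
  let ι : ((cmDatum L 3 (Matrix.of fun i j : Fin 3 => if i.val + j.val + 1 = 3 then (1 : L) else 0)).Local v) →* GL (Fin 3) (w.1.adicCompletion L) :=
    (Subgroup.subtype _).comp
      (localNonsplitEquiv (IsCMField.complexConj L) (Matrix.of fun i j : Fin 3 => if i.val + j.val + 1 = 3 then (1 : L) else 0) hc1 w hw).toMulEquiv.toMonoidHom
  have hιe : ∀ u, ι u = ((localNonsplitEquiv (IsCMField.complexConj L) (Matrix.of fun i j : Fin 3 => if i.val + j.val + 1 = 3 then (1 : L) else 0) hc1 w hw u :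
      ↥(unitaryGroupOfForm (galAdicCompletionMap (L := L) (IsCMField.complexConj L) hw)
        (placeForm (Matrix.of fun i j : Fin 3 => if i.val + j.val + 1 = 3 then (1 : L) else 0) w.1))) : GL (Fin 3) (w.1.adicCompletion L)) := fun _ => rfl
  have hKt' : ∀ u, u ∈ Kt ↔ mapGL (ι u) N = N := fun u => by rw [hιe]; exact hKt u
  have htype : ∀ u, IsVertexLattice (galAdicCompletionMap (L := L) (IsCMField.complexConj L) hw) ϖ ((StdForm.antidiagonal 3).over (w.1.adicCompletion L)) 2
      (mapGL (ι u) N) := by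
    intro u
    refine isVertexLattice_mapGL (galAdicCompletionMap (L := L) (IsCMField.complexConj L) hw) ϖ _ (ι u) ?_ hN
    rw [hιe, ← hpf]
    exact (localNonsplitEquiv (IsCMField.complexConj L) (Matrix.of fun i j : Fin 3 => if i.val + j.val + 1 = 3 then (1 : L) else 0) hc1 w hw u).2
  have htr : ∀ M : Submodule 𝒪[w.1.adicCompletion L] (Fin 3 → w.1.adicCompletion L),
      IsVertexLattice (galAdicCompletionMap (L := L) (IsCMField.complexConj L) hw) ϖ ((StdForm.antidiagonal 3).over (w.1.adicCompletion L)) 2 M →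
        ∃ u, mapGL (ι u) N = M := by
    intro M hM
    obtain ⟨u₁, hu₁⟩ := exists_unitary_mapGL_eq_of_isVertexLattice_two_ramifiedCM L w hw he hϖ hN hM
    have hu₁' : (u₁ : GL (Fin 3) (w.1.adicCompletion L)) ∈ unitaryGroupOfForm (galAdicCompletionMap (L := L) (IsCMField.complexConj L) hw)
        (placeForm (Matrix.of fun i j : Fin 3 => if i.val + j.val + 1 = 3 then (1 : L) else 0) w.1) := by
      rw [hpf]; exact u₁.2
    refine ⟨(localNonsplitEquiv (IsCMField.complexConj L) (Matrix.of fun i j : Fin 3 => if i.val + j.val + 1 = 3 then (1 : L) else 0) hc1 w hw).symm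
      ⟨(u₁ : GL (Fin 3) (w.1.adicCompletion L)), hu₁'⟩, ?_⟩
    rw [hιe, ContinuousMulEquiv.apply_symm_apply]
    exact hu₁
  -- `γ` is regular with compact centraliser (the `E_v`-eigenframe)
  obtain ⟨Q, u, hQ, hu, hu1⟩ := exists_eigenframe_localRing_of_coe_eq_smul_frameElt L w hw γ hf hα hβ hz hαβ hα1 hβ1 b hΓ hγ
  have hreg : IsRegularElt (γ.val : GL (Fin 3) (LocalRing L v)) :=
    isRegularElt_of_eigenframe L (Matrix.of fun i j : Fin 3 => if i.val + j.val + 1 = 3 then (1 : L) else 0) w hw γ hQ hu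
  haveI : CompactSpace (Subgroup.centralizer ({γ} : Set ((cmDatum L 3 (Matrix.of fun i j : Fin 3 => if i.val + j.val + 1 = 3 then (1 : L) else 0)).Local v))) :=
    compactSpace_centralizer_of_eigenframe_of_smul_eq L w hw (Matrix.of fun i j : Fin 3 => if i.val + j.val + 1 = 3 then (1 : L) else 0) hH hdet γ hQ hu hu1
  -- the fixed-coset reading and the dictionary
  rw [classOrbitalIntegral_indicator_complex_local_eq_natCard_fixedBy_mul L 3 (Matrix.of fun i j : Fin 3 => if i.val + j.val + 1 = 3 then (1 : L) else 0) v νG₃ hH hdet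
      hcan Kt hKo hKc γ hreg,
    natCard_fixedBy_quotient_eq_fixedVertexCount_of_coe_eq_smul ι N Kt (galAdicCompletionMap (L := L) (IsCMField.complexConj L) hw) ϖ 2 hvσ hKt' htype htr γ hz Γ
      (by rw [hιe]; exact hγ), mul_comm]


/-- **THE CENSUS DICTIONARY AT THE TYPE-`2` ANCHOR — `AnchorCountDictionary 2` HOLDS**, with the constant `C := νG₃(K₂)` (it depends on the measure and the vertex only,
as the Prop's quantifier order `∀ N ∀ K₂ ∃ C` allows); the unused binder `¬ IsUnit 2` shows the dictionary holds at EVERY ramified place, not only the dyadic ones.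
[cite: Kottwitz1986BaseChangeUnits, §1 pp. 240–241] [cite: Rogawski1990, §4.9 Prop. 4.9.1 (b) p. 55; §4.3 (4.3.1) p. 43] [cite: Laumon1995, Lemma (5.3.2) p. 136] -/
theorem anchorCountDictionary_two : F0P3cDyRamFourFrameDictionaryDefs.AnchorCountDictionary 2 := by
  intro L _ _ _ v w hw he _h2 ϖ hϖ _ _ _ _ νG₃ _ _ mG₃ hcan N hN Kt hKt
  exact ⟨_, fun f hf α β z hα hβ hz hαβ hα1 hβ1 b Γ hΓ γ hγ =>
    classOrbitalIntegral_indicator_eq_mul_fixedVertexCount_two L w hw he hϖ νG₃ hcan hN Kt hKt hf hα hβ hz hαβ hα1 hβ1 b hΓ γ hγ⟩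

end Head

end Summit.HodgeConjecture.HodgeConjecture.Cruxes.H413.F0P3cDyRamAnchorCountDictionaryTwo

end
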